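import Summits.AtomisticToContinuum.BoseEinsteinCondensation.Theses.BECConjugateDomination
import Literature.MathematicalPhysics.QuantumManyBody.BoseGasCatStates
import Literature.MathematicalPhysics.QuantumManyBody.BoseGasFreeDirichletBEC

/-!
# Negative lemmas for crux `HardCoreExtension` (stmt-AtomisticToContinuum-11786) — I: the
# high-density obstruction and the false monotone transfer

Supports (does not close) stmt-AtomisticToContinuum-11786 (route `BECConjugateDomination`, rank 5):
`HardCoreExtension := SmoothClassBEC → BoseEinsteinCondensation` — ground-state BEC at all small
densities for every potential of the smooth class (repulsive finite range, finite, `C²` as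
`x ↦ v(|x|)`, edge condition `‖D²ṽ‖ ≤ Cₑ√ṽ` — the four curried hypotheses of the antecedent) implies the conjunct for EVERY repulsive finite-range `v`, hard
cores included. Importable form of §3 of the cdisprove seat's standing file
`Cruxes/HardCoreExtension/Disproof.lean` (generation 1). Nothing here mentions a `Theses` decl.

* §A PACKED BOXES. `condensateNumber_le_maxOccupation_of_groundStateEnergy_eq_top`,
  `condensateNumber_eq_zero_of_groundStateEnergy_eq_top`: when no trial state of `Λ_L` has finite
  energy (`E₀^D(N,L) = ⊤`), the near-minimiser constraint in `condensateNumber` is void, every trial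
  state competes, and the cat states of `BoseGasCatStates` (`λ_max ≤ N/m³` for every `m`) force
  `condensateNumber v N L = 0` (`N ≥ 2`).
* §B HARD CORES ABOVE `8/a³`. `condensateNumber_hardCorePotential_eq_zero` (pigeonhole
  `⌈2L/a⌉³ < N`), `not_hasGroundStateBEC_hardCorePotential` (`ρ > 8/a³`): the hard-sphere gas — a
  member of the conjunct's class outside the smooth class — has NO ground-state BEC at high density
  in the typed sense. Hence `not_hasGroundStateBEC_allDensities` (the `ρ₀` of the conjunct is
  load-bearing on the hard-core side) and the two refuted comparison principles
  `not_hasGroundStateBEC_mono_potential` (thermodynamic: `v ≤ w`, BEC for `v` at density `ρ` ⇏ BEC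
  for `w` at `ρ`; witness `0 ≤` hard core, `ρ = 9 > 8`) and `not_condensateNumber_mono_potential`
  (finite volume: `v ≤ w ⇏ condensateNumber v N L ≤ condensateNumber w N L`; witness `N = 9`, `L = a = 1`,
  where the free value is `≥ c·9 > 0 = ` the hard-core value).
* §C THE ANTECEDENT'S CLASS HAS NO SUCH OBSTRUCTION. `lintegral_ne_top_of_finite_continuous`
  (`∫ v(|x|)dx < ∞` for finite finite-range `v` continuous as `x ↦ v(|x|)`), hence for every finite
  `v` of the class with `x ↦ v(|x|)` of class `C²` (the first three hypotheses of the antecedent; the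
  edge condition is not needed): `criticalDensity v = ⊤` (`criticalDensity_eq_top_of_finite_contDiff`)
  and `E₀^D(N,L) < ⊤` for all `N ≥ 1`, `L > 0` (`groundStateEnergy_lt_top_of_finite_contDiff`), while
  `criticalDensity (hardCorePotential a) ≤ 8/a³` (tree) and the hard core violates the finiteness
  hypothesis (`hardCorePotential_not_finite`); the free gas satisfies all four hypotheses
  (`contDiff_profile_zero`, `edgeCondition_zero`), so the antecedent is not vacuous and —
  `hasGroundStateBEC_zero` / `boseEinsteinCondensation_at_zero` (tree) — holds there.
* §D `monotoneDiluteTransfer_iff_conjunct`: the only monotone comparison principle weak enough to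
  survive §B — transfer of DILUTE BEC upward along `v ≤ w`, spelled out inline (no new def) — is
  equivalent to the conjunct itself (apply it to `0 ≤ w`), so it is no shortcut to the crux.

What this says to a prover of the crux: any transfer of BEC from smooth approximants `vₙ ↑ ⊤·1_{r<a}`
to the hard core must break down above `8/a³` although nothing breaks down in the smooth class at
any density (`ρ_c = ∞` there); i.e. the mechanism must consume diluteness `ρ·a(v)³ ≪ 1` on the
hard-core side quantitatively — no density-uniform comparison/monotonicity/continuity of
`λ_max(γ_{Ψ₀})` in `v` exists (§B refutes the monotone one outright; LSSY2005 Ch. 2 Lemma 2.5 /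
Dyson's lemma move energies only).

References: LSSY2005 = Lieb–Seiringer–Solovej–Yngvason, *The Mathematics of the Bose Gas and its
Condensation* (2005), §1.2 (1.17)–(1.19), Ch. 2 (hard core after (2.1)), Ch. 5; Ruelle 1969 §3.3.12
(close packing due to hard cores); Mueller–Ho–Ueda–Baym, Phys. Rev. A 74 (2006) 033612 §II.C
(cat-state fragmentation). `[folklore]` throughout.
-/

namespace Summit.AtomisticToContinuum.BoseEinsteinCondensation.Theorems.HardCoreExtension.Negative

open MeasureTheory Filter Metric
open scoped ENNReal Topology
open Literature.MathematicalPhysics.QuantumManyBody.BoseGas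

noncomputable section

/-! ## §A Packed boxes: a void near-minimiser constraint empties the condensate number -/

/-- If `E₀^D(N, L) = ⊤` (no trial state of finite energy) then every trial state is a
"near-minimiser" and bounds the condensate number from above by its own `λ_max(γ)`. [folklore] -/
theorem condensateNumber_le_maxOccupation_of_groundStateEnergy_eq_top {v : ℝ → ℝ≥0∞} {N : ℕ}
    {L : ℝ} (hE : groundStateEnergy v N L = ⊤) (Ψ : TrialState N L) :
    condensateNumber v N L ≤ maxOccupation N Ψ.ψ := by
  refine iSup₂_le fun δ _ => ?_
  exact iInf₂_le Ψ (by rw [hE, top_add]; exact le_top)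

/-- **Packed boxes carry no condensate**: if `E₀^D(N, L) = ⊤`, `N ≥ 2`, `L > 0`, then
`condensateNumber v N L = 0` — the cat states `Ψ_cat` (all particles together in one of `m³`
sub-cubes, superposed; `λ_max ≤ N/m³`, `BoseGasCatStates.exists_fragmented_trialState`) compete for
every `m`. [folklore] -/
theorem condensateNumber_eq_zero_of_groundStateEnergy_eq_top {v : ℝ → ℝ≥0∞} {N : ℕ} {L : ℝ}
    (hE : groundStateEnergy v N L = ⊤) (hN : 2 ≤ N) (hL : 0 < L) :
    condensateNumber v N L = 0 := by
  refine le_antisymm ?_ bot_le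
  have h3 : Tendsto (fun m : ℕ => ((m : ℝ)) ^ 3) atTop atTop :=
    (tendsto_pow_atTop three_ne_zero).comp tendsto_natCast_atTop_atTop
  have hlim : Tendsto (fun m : ℕ => ENNReal.ofReal ((N : ℝ) / (m : ℝ) ^ 3)) atTop (𝓝 0) := by
    rw [← ENNReal.ofReal_zero]
    exact ENNReal.tendsto_ofReal (tendsto_const_nhds.div_atTop h3)
  refine ge_of_tendsto hlim ?_
  filter_upwards [eventually_gt_atTop 0] with m hm
  obtain ⟨Ψ, -, hocc⟩ := exists_fragmented_trialState hm hN hL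
  exact (condensateNumber_le_maxOccupation_of_groundStateEnergy_eq_top hE Ψ).trans hocc

/-! ## §B Hard cores above `8/a³`: no BEC, and the monotone transfer is false -/

/-- **Too many hard spheres: no condensate.** For the hard-core potential of radius `a` in a box
with `⌈2L/a⌉³ < N` (pigeonhole: two cores overlap in every configuration, so every trial state has
infinite energy, `groundStateEnergy_hardCorePotential_eq_top`), `condensateNumber = 0`. [folklore] -/
theorem condensateNumber_hardCorePotential_eq_zero {a L : ℝ} (ha : 0 < a) {N : ℕ}
    (hpack : ⌈2 * L / a⌉₊ ^ 3 < N) (hN : 2 ≤ N) (hL : 0 < L) :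
    condensateNumber (hardCorePotential a) N L = 0 :=
  condensateNumber_eq_zero_of_groundStateEnergy_eq_top
    (groundStateEnergy_hardCorePotential_eq_top ha hpack) hN hL

/-- **No ground-state BEC for hard spheres above `8/a³`** (in the typed sense `HasGroundStateBEC`):
along `L_N = (N/ρ)^{1/3}` with `ρ > 8/a³` the boxes are eventually packed
(`eventually_ceil_sideLength_pow_lt`), so `condensateNumber = 0 < cN`. The conjunct's restriction
to small densities is therefore load-bearing for the hard-core members of its class. [folklore] -/
theorem not_hasGroundStateBEC_hardCorePotential {a : ℝ} (ha : 0 < a) {ρ : ℝ} (hρ : 8 / a ^ 3 < ρ) :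
    ¬ HasGroundStateBEC (hardCorePotential a) ρ := by
  rintro ⟨c, hc, hev⟩
  have hρ0 : 0 < ρ := lt_trans (by positivity) hρ
  obtain ⟨N, hpack, hN2, hbec⟩ :=
    ((eventually_ceil_sideLength_pow_lt ha hρ).and ((eventually_ge_atTop 2).and hev)).exists
  have hL : 0 < sideLength ρ N := sideLength_pos_of_pos hρ0 (by omega)
  have h0 := condensateNumber_hardCorePotential_eq_zero ha hpack hN2 hL
  rw [h0, nonpos_iff_eq_zero, ENNReal.ofReal_eq_zero] at hbec
  have hN' : (0 : ℝ) < N := by exact_mod_cast (show 0 < N by omega)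
  nlinarith

/-- **BEC at ALL densities is false for the conjunct's class**: the all-density strengthening of
`BoseEinsteinCondensation` fails at the hard-sphere gas (`a = 1`, `ρ = 9`). [folklore] -/
theorem not_hasGroundStateBEC_allDensities :
    ¬ ∀ v : ℝ → ℝ≥0∞, IsRepulsiveFiniteRange v → ∀ ρ : ℝ, 0 < ρ → HasGroundStateBEC v ρ := fun h =>
  not_hasGroundStateBEC_hardCorePotential one_pos (by norm_num : (8 : ℝ) / 1 ^ 3 < 9)
    (h _ (isRepulsiveFiniteRange_hardCorePotential 1) 9 (by norm_num))

/-- **The monotone transfer of BEC along `v ≤ w` is false** (thermodynamic form): it is NOT the case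
that for admissible `v ≤ w` and every density, ground-state BEC for `v` implies it for `w`.
Witness: `v = 0` (free gas, BEC at every density, `hasGroundStateBEC_zero`) `≤ w =` hard core of
radius `1`, at `ρ = 9 > 8`. This is the comparison principle that would yield the crux from the free
gas alone; its dilute remnant is the conjunct itself (`monotoneDiluteTransfer_iff_conjunct`). [folklore] -/
theorem not_hasGroundStateBEC_mono_potential :
    ¬ ∀ v w : ℝ → ℝ≥0∞, IsRepulsiveFiniteRange v → IsRepulsiveFiniteRange w → (∀ r, v r ≤ w r) →
        ∀ ρ : ℝ, 0 < ρ → HasGroundStateBEC v ρ → HasGroundStateBEC w ρ := fun h =>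
  not_hasGroundStateBEC_hardCorePotential one_pos (by norm_num : (8 : ℝ) / 1 ^ 3 < 9)
    (h 0 (hardCorePotential 1) ⟨measurable_const, 0, fun _ _ => rfl⟩
      (isRepulsiveFiniteRange_hardCorePotential 1) (fun _ => by simp) 9 (by norm_num)
      (hasGroundStateBEC_zero (by norm_num)))

/-- **… and false in every fixed box, too**: `condensateNumber` is not monotone in the potential —
`v ≤ w ⇏ condensateNumber v N L ≤ condensateNumber w N L`. Witness `N = 9`, `L = 1`, `v = 0`, `w =`
hard core of radius `1` (`⌈2⌉³ = 8 < 9`): the free value is `≥ c·9 > 0`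
(`exists_condensateNumber_zero_ge`), the packed hard-core value is `0`. [folklore] -/
theorem not_condensateNumber_mono_potential :
    ¬ ∀ (v w : ℝ → ℝ≥0∞) (N : ℕ) (L : ℝ), (∀ r, v r ≤ w r) →
        condensateNumber v N L ≤ condensateNumber w N L := by
  intro h
  obtain ⟨c, hc, hfree⟩ := exists_condensateNumber_zero_ge
  have hceil : ⌈2 * (1 : ℝ) / 1⌉₊ = 2 := by norm_num
  have hpack : ⌈2 * (1 : ℝ) / 1⌉₊ ^ 3 < 8 + 1 := by rw [hceil]; norm_num
  have h0 := condensateNumber_hardCorePotential_eq_zero one_pos hpack (by norm_num) one_pos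
  have hle := (hfree 8 1 one_pos).trans
    ((h 0 (hardCorePotential 1) (8 + 1) 1 fun _ => by simp).trans h0.le)
  rw [nonpos_iff_eq_zero, ENNReal.ofReal_eq_zero] at hle
  push_cast at hle
  nlinarith

/-! ## §C The antecedent's class has no packing obstruction -/

/-- A finite, finite-range profile that is continuous as `x ↦ v(|x|)` on `ℝ³` is integrable there:
`∫_{ℝ³} v(|x|) dx < ∞` (bounded with compact support). [folklore] -/
theorem lintegral_ne_top_of_finite_continuous {v : ℝ → ℝ≥0∞} (hv : IsRepulsiveFiniteRange v)
    (hfin : ∀ r, v r ≠ ⊤) (hcont : Continuous fun x : Space => (v ‖x‖).toReal) :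
    (∫⁻ x : Space, v ‖x‖) ≠ ⊤ := by
  obtain ⟨R₀, hR₀⟩ := hv.2
  have hsupp : Function.support (fun x : Space => v ‖x‖) ⊆ closedBall (0 : Space) (max R₀ 0) := by
    intro x hx
    rw [mem_closedBall, dist_zero_right]
    by_contra hlt
    exact hx (hR₀ _ ((le_max_left _ _).trans_lt (not_le.1 hlt)))
  have hfs : HasCompactSupport fun x : Space => (v ‖x‖).toReal := by
    refine HasCompactSupport.intro (isCompact_closedBall (0 : Space) (max R₀ 0)) fun x hx => ?_
    have h0 : v ‖x‖ = 0 := Function.notMem_support.1 fun h => hx (hsupp h)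
    simp [h0]
  obtain ⟨C, hC⟩ := hcont.bounded_above_of_compact_support hfs
  have hpt : ∀ x : Space, v ‖x‖ ≤ ENNReal.ofReal C := fun x => by
    rw [← ENNReal.ofReal_toReal (hfin ‖x‖)]
    exact ENNReal.ofReal_le_ofReal ((le_abs_self _).trans ((Real.norm_eq_abs _).symm.trans_le (hC x)))
  rw [← setLIntegral_eq_of_support_subset hsupp]
  refine ne_top_of_le_ne_top ?_ (setLIntegral_mono measurable_const fun x _ => hpt x)
  rw [setLIntegral_const]
  exact ENNReal.mul_ne_top ENNReal.ofReal_ne_top measure_closedBall_lt_top.ne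

/-- **No critical density in the antecedent's class**: `ρ_c(v) = ∞` for every finite `v` of the
class with `x ↦ v(|x|)` of class `C²` (contrast: `criticalDensity (hardCorePotential a) ≤ 8/a³`).
[folklore] -/
theorem criticalDensity_eq_top_of_finite_contDiff {v : ℝ → ℝ≥0∞} (hv : IsRepulsiveFiniteRange v)
    (hfin : ∀ r, v r ≠ ⊤) (hC : ContDiff ℝ 2 fun x : Space => (v ‖x‖).toReal) :
    criticalDensity v = ⊤ :=
  criticalDensity_eq_top_of_lintegral_ne_top hv
    (lintegral_ne_top_of_finite_continuous hv hfin hC.continuous)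

/-- **No packed boxes in the antecedent's class**: `E₀^D(N, L) < ∞` for every such `v`, every
`N ≥ 1` and every `L > 0` — so the mechanism of §A–§B never fires for a smooth-class potential, at
any density. [folklore] -/
theorem groundStateEnergy_lt_top_of_finite_contDiff {v : ℝ → ℝ≥0∞} (hv : IsRepulsiveFiniteRange v)
    (hfin : ∀ r, v r ≠ ⊤) (hC : ContDiff ℝ 2 fun x : Space => (v ‖x‖).toReal) {N : ℕ} (hN : 0 < N)
    {L : ℝ} (hL : 0 < L) : groundStateEnergy v N L < ⊤ :=
  groundStateEnergy_lt_top_of_lintegral_ne_top' hv.1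
    (lintegral_ne_top_of_finite_continuous hv hfin hC.continuous) hL hN

/-- The hard-sphere gas is in the conjunct's class but violates the antecedent's finiteness
hypothesis: the crux genuinely has to manufacture BEC for it. [folklore] -/
theorem hardCorePotential_not_finite {a : ℝ} (ha : 0 < a) :
    IsRepulsiveFiniteRange (hardCorePotential a) ∧ ¬ ∀ r, hardCorePotential a r ≠ ⊤ :=
  ⟨isRepulsiveFiniteRange_hardCorePotential a, fun h => h 0 (hardCorePotential_of_lt ha)⟩

/-- The free gas satisfies the antecedent's `C²` hypothesis … [folklore] -/
theorem contDiff_profile_zero : ContDiff ℝ 2 fun x : Space => ((0 : ℝ → ℝ≥0∞) ‖x‖).toReal := by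
  simpa using contDiff_const (c := (0 : ℝ))

/-- … and its edge condition (with `Cₑ = 0`), besides being admissible and finite: the antecedent is
not vacuous — and it HOLDS at the free gas (`hasGroundStateBEC_zero`), so the free gas is no
ex-falso exit for the crux either. [folklore] -/
theorem edgeCondition_zero : ∃ Cₑ : ℝ, ∀ x : Space,
    ‖iteratedFDeriv ℝ 2 (fun x : Space => ((0 : ℝ → ℝ≥0∞) ‖x‖).toReal) x‖ ≤
      Cₑ * Real.sqrt (((0 : ℝ → ℝ≥0∞) ‖x‖).toReal) :=
  ⟨0, fun x => by simp⟩

/-! ## §D The dilute monotone transfer is the conjunct -/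

/-- **The dilute monotone transfer is equivalent to the conjunct.** The principle "along admissible
`v ≤ w`, ground-state BEC at all small densities passes from `v` to `w`" (left side, spelled out)
holds iff `BoseEinsteinCondensation` does (`→`: apply it to `0 ≤ w` and the free gas; `←`: its
conclusion is the conjunct's). So the one comparison principle not refuted by §B is exactly as hard
as the conjunct, not a route to the crux. [folklore] -/
theorem monotoneDiluteTransfer_iff_conjunct :
    (∀ v w : ℝ → ℝ≥0∞, IsRepulsiveFiniteRange v → IsRepulsiveFiniteRange w → (∀ r, v r ≤ w r) →
        (∃ ρ₀ : ℝ, 0 < ρ₀ ∧ ∀ ρ : ℝ, 0 < ρ → ρ < ρ₀ → HasGroundStateBEC v ρ) →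
          ∃ ρ₀ : ℝ, 0 < ρ₀ ∧ ∀ ρ : ℝ, 0 < ρ → ρ < ρ₀ → HasGroundStateBEC w ρ) ↔
      Literature.MathematicalPhysics.QuantumManyBody.BoseGas.BoseEinsteinCondensation :=
  ⟨fun h w hw => h 0 w ⟨measurable_const, 0, fun _ _ => rfl⟩ hw (fun _ => by simp)
      boseEinsteinCondensation_at_zero,
    fun h _ w _ hw _ _ => h w hw⟩

end

end Summit.AtomisticToContinuum.BoseEinsteinCondensation.Theorems.HardCoreExtension.Negative
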